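import Mathlib
import Summits.AtomisticToContinuum.HydrodynamicLimit.Theorems.ImplosionDichotomyDenseExcursionPackingAnalyticDefsC
import Summits.AtomisticToContinuum.HydrodynamicLimit.Theorems.ImplosionDichotomyDenseExcursionSonicCavityDefsD
import Summits.AtomisticToContinuum.HydrodynamicLimit.Theorems.ImplosionDichotomyDenseExcursionPackingResolventExistenceW
import Summits.AtomisticToContinuum.HydrodynamicLimit.Theorems.ImplosionDichotomyDenseExcursionPackingResolventCore
import Summits.AtomisticToContinuum.HydrodynamicLimit.Theorems.ImplosionDichotomyDenseExcursionPackingResolventProfileFacts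
import Summits.AtomisticToContinuum.HydrodynamicLimit.Theorems.ImplosionDichotomyDenseExcursionPackingResolventFarFieldGain

/-!
# Stub `stub_packingResolventW` of line `sonic-cavity-renewal` (v8): the packing-order resolvent with the
# centre-correct weight (crux `DenseExcursion`, stmt-AtomisticToContinuum-12586)

Proof file (`--supports stmt-AtomisticToContinuum-12586`) for the registered stub `stub_packingResolventW` (skeleton v8,
lead a2; wave-4 worker C1); also the registered helper `packingResolventW_apriori` (the a-priori estimate it rests on). `PackingResolventW r W S` (`…PackingAnalyticDefsC`): at every packing order `Λ = kμ`,
`μ = 3(r − 1)`, `k ≥ 1`, every smooth centre-regular real source with `|f₁|/(1 + S) + |f₂|/S ≤ N` has a smooth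
centre-regular real solution of `kμ·u − Lu = f` with finite global weighted sup, and from some order `k₀` on the Laplace
gain `|u₁|/(1 + S) + |u₂|/S ≤ CN/k` holds together with the `k`-uniform unweighted bound `|u₁| ≤ CN`.

**Proof.** EXISTENCE at every order is the landed `packingResolvent_existenceW` (p157720: the real part of the
`CavityResolventCk 5` solution at `Λ = kμ`, globally weighted-bounded by the far-field lemma). THE GAIN is the landed
a-priori estimate `packingResolventW_apriori` applied to that very solution for `kμ ≥ Λ₀` (no uniqueness needed): a
barrier / weighted-maximum-principle argument at real `Λ → ∞` with four gauges — `|U|/Ū`, `|Z|/Z̄` in the acoustic layer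
`x ≤ x_Λ = log(2s₀/Λ)` (variables `u₁` and `V = Λe^{2x}Su₂/s₀²`, the `O(1/Λ)`-perturbed forced modified-spherical-Bessel
system, comparison with the truncated growing mode `φ(ρ), ψ(ρ)`, `ρ = Λeˣ/s₀ ≤ 2`), `|P|/P̄`, `|M|/M̄` for the
characteristic fields outside (the repulsive sonic point costs nothing: no sign condition on the speed at interior touching
points), closed by the reflection bound `|ψ(2)/φ(2) − 3/2| = 0.694` at the interface; the unweighted bound `|u₁| ≤ CN` holds
for ALL weighted-bounded sources (the `w`-component is `O(N)` in the acoustic layer and `O(N(1 + S)/Λ) ≤ O(N)` outside), so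
the Option-B conjunct follows a fortiori. For `N = 0` the source vanishes and the zero pair is the required solution.
Hypotheses `OrigProfileEqs`, `CavityTubeWedgeLoop`, `CavityTubeBulk`, `BoxPackage`, `RealBound`, `SonicConfinement` of the
registered signature are not needed by this route (uniqueness is never invoked).
-/

noncomputable section

open Set Filter Topology
open scoped ContDiff

namespace Summit.AtomisticToContinuum.HydrodynamicLimit.Theorems.PackingAnalyticImplosion

open Summit.AtomisticToContinuum.HydrodynamicLimit.Theorems.R2OneModeTwoConditions
open Summit.AtomisticToContinuum.HydrodynamicLimit.Theorems.SonicCavityRenewal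

/-- **Registered helper `packingResolventW_apriori` of `stub_packingResolventW`: THE A-PRIORI GAIN ESTIMATE.** For a
monatomic profile in the cavity tube on the pinned window there are `Λ₀, C > 0` such that for every real `Λ ≥ Λ₀`, every
differentiable real solution `(u₁, u₂)` of the real resolvent system `Λu − Lu = f` with a continuous `(1 + S)`-weighted
source of size `N > 0` and FINITE global weighted sup `|u₁| + |u₂|/S` satisfies `|u₁|/(1 + S) + |u₂|/S ≤ CN/Λ` and
`|u₁| ≤ CN` everywhere: assembly of `packingResolventW_core` (barrier bounds), the digested tube and qualitative profile
facts (`packingResolventW_tubeDigest`, `profile_bounds_Ici`, `profile_farField_window`) and the far-field step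
`packingResolventW_farFieldQ`; `Λ₀ = max(1000, 700B₀²)`, `C = 400 + 1/S_L` (`S_L` = min of `S` on `[0, X_F]`). [folklore] -/
theorem packingResolventW_apriori : ∀ (r : ℝ) (W S : ℝ → ℝ), (17307 / 15625 : ℝ) ≤ r → r ≤ 697 / 625 → IsMonatomicProfile r W S → CavityTube r W S → ∃ Λ₀ C : ℝ, 0 < Λ₀ ∧ 0 < C ∧ ∀ Λ : ℝ, Λ₀ ≤ Λ → ∀ (u₁ u₂ f₁ f₂ : ℝ → ℝ) (N N' : ℝ), 0 < N → Differentiable ℝ u₁ → Differentiable ℝ u₂ → Continuous f₁ → Continuous f₂ → (∀ x, Λ * u₁ x - ((W x - 1) * deriv u₁ x + 3 * S x * deriv u₂ x + (deriv W x + 2 * W x - r) * u₁ x + (3 * deriv S x + 6 * S x) * u₂ x) = f₁ x ∧ Λ * u₂ x - (S x / 3 * deriv u₁ x + (W x - 1) * deriv u₂ x + (deriv S x + 2 * S x) * u₁ x + (deriv W x / 3 + 2 * W x - r) * u₂ x) = f₂ x) → (∀ y, |f₁ y| / (1 + S y) + |f₂ y| / S y ≤ N) → (∀ y, |u₁ y|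 + |u₂ y| / S y ≤ N') → ∀ y, |u₁ y| / (1 + S y) + |u₂ y| / S y ≤ C * N / Λ ∧ |u₁ y| ≤ C * N := by
  intro r W S hr1 hr2 hP hT
  obtain ⟨s₀, hs₀, hs₀', htd5, htc, hsup, hsub', h0, hSanti⟩ := packingResolventW_tubeDigest r W S hP hT
  obtain ⟨B₀, hB, hB0⟩ := profile_bounds_Ici hP
  obtain ⟨XF, hXF1, hwin⟩ := profile_farField_window hP
  obtain ⟨-, -, hWs, hSs, hSpos, -, -, -, -⟩ := hP
  have hWc : Continuous W := hWs.continuous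
  have hSd : Differentiable ℝ S := hSs.differentiable (by simp)
  have hSc : Continuous S := hSs.continuous
  have hr1' : (1:ℝ) ≤ r := by linarith
  have hr2' : r ≤ 2 := by linarith
  have hs0 : 0 < s₀ := by linarith
  -- the minimum of `S` on `[0, X_F]` bounds `S` from below on `x ≤ X_F`
  obtain ⟨xm, hxm, hmin⟩ := (isCompact_Icc : IsCompact (Icc (0:ℝ) XF)).exists_isMinOn ⟨0, left_mem_Icc.2 (by linarith)⟩
    hSc.continuousOn
  obtain ⟨SL, hSL⟩ : ∃ SL : ℝ, SL = S xm := ⟨_, rfl⟩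
  have hSLpos : 0 < SL := by rw [hSL]; exact hSpos xm
  have hSlow : ∀ x, x ≤ XF → SL ≤ S x := by
    intro x hx
    rw [hSL]
    rcases le_or_gt 0 x with h0x | h0x
    · exact hmin ⟨h0x, hx⟩
    · have h1 : S xm ≤ S 0 := hmin ⟨le_rfl, by linarith⟩
      exact h1.trans (hSanti x 0 h0x.le (by norm_num))
  have htd4 : ∀ x, x ≤ 0 → |W x - (r - 1)| ≤ Real.exp x ^ 2 / 10 + 2 * Real.exp x ^ 4 ∧
      |deriv W x| ≤ Real.exp x ^ 2 / 5 + 2 * Real.exp x ^ 4 ∧ |Real.exp x * S x - s₀| ≤ Real.exp x ^ 2 / 10 + 2 * Real.exp x ^ 4 ∧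
      |Real.exp x * (S x + deriv S x)| ≤ Real.exp x ^ 2 / 5 + 2 * Real.exp x ^ 4 :=
    fun x hx => ⟨(htd5 x hx).1, (htd5 x hx).2.1, (htd5 x hx).2.2.1, (htd5 x hx).2.2.2.1⟩
  have hτ : ∀ x, x ≤ 0 → |S x + deriv S x| ≤ 11 / 5 := fun x hx => (htd5 x hx).2.2.2.2
  have hsub : ∀ x, 0 ≤ x → W x + S x ≤ 1 := by
    intro x hx
    rcases eq_or_lt_of_le hx with h | h
    · rw [← h]; exact h0.le
    · exact (hsub' x h).le
  refine ⟨max 1000 (700 * B₀ ^ 2), 400 + 1 / SL, by positivity, by positivity, ?_⟩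
  intro Λ hΛ u₁ u₂ f₁ f₂ N N' hN hu₁ hu₂ hf₁c hf₂c heq hf hN'
  have hΛ1 : 1000 ≤ Λ := le_trans (le_max_left _ _) hΛ
  have hΛB : 700 * B₀ ^ 2 ≤ Λ := le_trans (le_max_right _ _) hΛ
  have hΛpos : 0 < Λ := by linarith
  have hNΛ : 0 < N / Λ := div_pos hN hΛpos
  obtain ⟨hin, hout⟩ := packingResolventW_core r Λ s₀ N N' B₀ W S u₁ u₂ f₁ f₂ hr1 hr2 hΛ1 hB hΛB hs₀ hs₀' hN hSpos hWc hSd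
    hu₁ hu₂ hf₁c hf₂c htc htd4 hτ hsup hsub hB0 hSanti heq hf hN'
  obtain ⟨xL, hxL_def⟩ : ∃ xL : ℝ, xL = Real.log (2 * s₀ / Λ) := ⟨_, rfl⟩
  rw [← hxL_def] at hin hout
  have hxL : Real.exp xL = 2 * s₀ / Λ := by rw [hxL_def]; exact Real.exp_log (by positivity)
  have hxLneg : xL < 0 := by
    have h1 : Real.exp xL < 1 := by rw [hxL, div_lt_one hΛpos]; linarith
    exact Real.exp_lt_one_iff.1 h1
  -- `S` is at most `Λ/(2 s₀) ≤ Λ/1.4` on `[x_Λ, 1]` and at most `B₀ ≤ Λ/700` on `x ≥ 0`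
  have hSup : ∀ x, xL ≤ x → S x ≤ 72 / 100 * Λ := by
    intro x hx
    rcases le_or_gt x 1 with h1 | h1
    · have h2 : S x ≤ S xL := hSanti xL x hx h1
      obtain ⟨-, -, -, hst2⟩ := htc xL (by linarith)
      have h3 : S xL * (2 * s₀) ≤ Λ := by
        have : S xL * Real.exp xL ≤ 1 := by rw [mul_comm]; exact hst2
        calc S xL * (2 * s₀) = S xL * Real.exp xL * Λ := by rw [hxL]; field_simp
          _ ≤ 1 * Λ := mul_le_mul_of_nonneg_right this hΛpos.le
          _ = Λ := one_mul Λ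
      have h4 : S xL * (14 / 10) ≤ S xL * (2 * s₀) := mul_le_mul_of_nonneg_left (by linarith) (hSpos xL).le
      linarith
    · obtain ⟨-, -, hSB, -⟩ := hB0 x (by linarith)
      have h2 : B₀ ≤ B₀ ^ 2 := by nlinarith only [hB]
      linarith
  -- source envelopes and the global bound on `q = u₂/S`
  have hsrc : ∀ x, |f₁ x| ≤ N * (1 + S x) ∧ |f₂ x| ≤ N * S x := by
    intro x
    have hSx := hSpos x
    have hfx := hf x
    constructor
    · have h1 : |f₁ x| / (1 + S x) ≤ N := by linarith [div_nonneg (abs_nonneg (f₂ x)) hSx.le]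
      rwa [div_le_iff₀ (by linarith)] at h1
    · have h1 : |f₂ x| / S x ≤ N := by linarith [div_nonneg (abs_nonneg (f₁ x)) (by linarith : (0:ℝ) ≤ 1 + S x)]
      rwa [div_le_iff₀ hSx] at h1
  have hqN' : ∀ x, |u₂ x / S x| ≤ N' := fun x => by
    rw [abs_div, abs_of_pos (hSpos x)]
    linarith [hN' x, abs_nonneg (u₁ x)]
  -- ===== the three pointwise gain facts =====
  have hXL : xL ≤ XF := by linarith
  have hw1 : ∀ y, xL ≤ y → |u₁ y| / (1 + S y) ≤ 875 / 10 * (N / Λ) := by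
    intro y hy
    have hSy := hSpos y
    rw [div_le_iff₀ (by linarith)]
    have h1 := (hout y hy).1
    have h2 : 0 ≤ N / Λ * S y := by positivity
    linarith
  have hw2 : ∀ y, xL ≤ y → y ≤ XF → |u₂ y| / S y ≤ N / Λ * (2 / (3 * SL) + 30) := by
    intro y hy hyF
    have hSy := hSpos y
    have h1 := (hout y hy).2
    rw [div_le_iff₀ hSy]
    have h2 : N / Λ * (4 + 175 * S y) / 6 ≤ N / Λ * (2 / (3 * SL) + 30) * S y := by
      have h3 : SL ≤ S y := hSlow y hyF
      have h4 : 4 / 6 ≤ 2 / (3 * SL) * S y := by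
        rw [div_mul_eq_mul_div, le_div_iff₀ (by positivity)]; linarith
      have h5 : (4 + 175 * S y) / 6 ≤ (2 / (3 * SL) + 30) * S y := by linarith
      calc N / Λ * (4 + 175 * S y) / 6 = N / Λ * ((4 + 175 * S y) / 6) := by ring
        _ ≤ N / Λ * ((2 / (3 * SL) + 30) * S y) := mul_le_mul_of_nonneg_left h5 hNΛ.le
        _ = _ := by ring
    exact h1.trans h2
  -- the far field
  have hu₁A : ∀ x, XF ≤ x → |u₁ x| ≤ 46 * (N / Λ) := by
    intro x hx
    have h1 := (hout x (by linarith)).1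
    have h2 := (hwin x hx).1
    have h3 : N / Λ * S x ≤ N / Λ * (1 / 2) := mul_le_mul_of_nonneg_left h2 hNΛ.le
    linarith
  have hq0 : |u₂ XF / S XF| ≤ N / Λ * (2 / (3 * SL) + 30) := by
    rw [abs_div, abs_of_pos (hSpos XF)]; exact hw2 XF hXL le_rfl
  have hfar := packingResolventW_farFieldQ r Λ XF (46 * (N / Λ)) (N / Λ * (2 / (3 * SL) + 30)) N N' W S u₁ u₂ f₁ f₂
    (by linarith) hr1' hr2' (by positivity) (by positivity) hN hSd hSpos hu₁ hu₂ hwin heq hu₁A (fun x _ => hsrc x) hqN' hq0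
  -- ===== conclusion =====
  intro y
  have hSy := hSpos y
  have hC1 : (175 : ℝ) * (N / Λ) ≤ (400 + 1 / SL) * N / Λ := by
    rw [mul_div_assoc]; exact mul_le_mul_of_nonneg_right (by linarith [one_div_pos.2 hSLpos]) hNΛ.le
  rcases le_or_gt y xL with hy | hy
  · -- the inner region
    obtain ⟨h1, h2⟩ := hin y hy
    obtain ⟨-, -, hst1, -⟩ := htc y (by linarith)
    have heΛ : Real.exp y * Λ ≤ 2 := by
      have : Real.exp y ≤ Real.exp xL := Real.exp_le_exp.2 hy
      rw [hxL] at this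
      rw [le_div_iff₀ hΛpos] at this
      linarith
    have hS35 : 35 / 100 * Λ ≤ S y := by
      have h5 : 7 / 10 * Λ ≤ Real.exp y * S y * Λ := mul_le_mul_of_nonneg_right hst1 hΛpos.le
      have h6 : Real.exp y * Λ * S y ≤ 2 * S y := mul_le_mul_of_nonneg_right heΛ hSy.le
      have e6 : Real.exp y * S y * Λ = Real.exp y * Λ * S y := by ring
      rw [e6] at h5
      linarith
    constructor
    · have h3 : |u₁ y| / (1 + S y) ≤ 95 * (N / Λ) := by
        rw [div_le_iff₀ (by linarith)]
        have : 95 * (N / Λ) * (1 + S y) ≥ 95 * (N / Λ) * (35 / 100 * Λ) :=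
          mul_le_mul_of_nonneg_left (hS35.trans (by linarith)) (by positivity)
        have e1 : 95 * (N / Λ) * (35 / 100 * Λ) = 3325 / 100 * N := by field_simp; norm_num
        linarith
      have h4 : 78 * N / Λ = 78 * (N / Λ) := by ring
      rw [h4] at h2
      linarith
    · have : 33 * N ≤ (400 + 1 / SL) * N := mul_le_mul_of_nonneg_right (by linarith [one_div_pos.2 hSLpos]) hN.le
      linarith
  · have hu1 : |u₁ y| ≤ (400 + 1 / SL) * N := by
      have h1 := (hout y hy.le).1
      have h2 := hSup y hy.le
      have h3 : N / Λ * (2 + 875 / 10 * S y) ≤ 65 * N := by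
        rw [div_mul_eq_mul_div, div_le_iff₀ hΛpos]
        have h4 : N * S y ≤ N * (72 / 100 * Λ) := mul_le_mul_of_nonneg_left h2 hN.le
        have h5 : N ≤ N * Λ := le_mul_of_one_le_right hN.le (by linarith)
        nlinarith only [h4, h5, hN, hΛpos]
      have : 65 * N ≤ (400 + 1 / SL) * N := mul_le_mul_of_nonneg_right (by linarith [one_div_pos.2 hSLpos]) hN.le
      linarith
    refine ⟨?_, hu1⟩
    rcases le_or_gt y XF with hyF | hyF
    · -- the bulk `x_Λ ≤ y ≤ X_F`
      have h1 := hw1 y hy.le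
      have h2 := hw2 y hy.le hyF
      have h3 : 875 / 10 * (N / Λ) + N / Λ * (2 / (3 * SL) + 30) ≤ (400 + 1 / SL) * N / Λ := by
        have h4 : 2 / (3 * SL) ≤ 1 / SL := by
          rw [div_le_div_iff₀ (by positivity) hSLpos]; linarith
        have h5 : N / Λ * (2 / (3 * SL)) ≤ N / Λ * (1 / SL) := mul_le_mul_of_nonneg_left h4 hNΛ.le
        have e5 : (400 + 1 / SL) * N / Λ = 400 * (N / Λ) + N / Λ * (1 / SL) := by ring
        rw [e5]; linarith
      linarith
    · -- the far field `y ≥ X_F`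
      have h1 := hw1 y hy.le
      have h2 := hfar y hyF.le
      rw [abs_div, abs_of_pos hSy] at h2
      have h3 : 875 / 10 * (N / Λ) + (2 * (46 * (N / Λ)) + 10 * N / Λ + N / Λ * (2 / (3 * SL) + 30)) ≤ (400 + 1 / SL) * N / Λ := by
        have h4 : 2 / (3 * SL) ≤ 1 / SL := by
          rw [div_le_div_iff₀ (by positivity) hSLpos]; linarith
        have h5 : N / Λ * (2 / (3 * SL)) ≤ N / Λ * (1 / SL) := mul_le_mul_of_nonneg_left h4 hNΛ.le
        have e1 : 10 * N / Λ = 10 * (N / Λ) := by ring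
        have e5 : (400 + 1 / SL) * N / Λ = 400 * (N / Λ) + N / Λ * (1 / SL) := by ring
        rw [e1, e5]; linarith
      linarith

open Literature.MathematicalPhysics.KineticTheory (V3)

/-- A real function whose complex coercion is a member of a regular pair is differentiable and continuous. [folklore] -/
theorem differentiable_real_of_coe_contDiffW {u : ℝ → ℝ} (h : ContDiff ℝ ∞ (fun x => (u x : ℂ))) :
    Differentiable ℝ u ∧ Continuous u := by
  have h1 : Differentiable ℝ (fun x => (u x : ℂ)) := h.differentiable (by simp)
  have h2 : Differentiable ℝ (fun x => ((u x : ℂ)).re) := fun x =>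
    (Complex.reCLM.hasFDerivAt.comp_hasDerivAt x (h1 x).hasDerivAt).differentiableAt
  have h3 : (fun x => ((u x : ℂ)).re) = u := funext fun x => Complex.ofReal_re _
  rw [h3] at h2
  exact ⟨h2, h2.continuous⟩

/-- The zero pair is a regular pair. [folklore] -/
theorem isRegularPair_zero_realW : IsRegularPair (fun _ : ℝ => ((0:ℝ) : ℂ)) (fun _ : ℝ => ((0:ℝ) : ℂ)) := by
  refine ⟨contDiff_const, contDiff_const, fun _ => 0, fun _ => 0, fun _ => 0, fun _ => 0,
    contDiff_const, contDiff_const, contDiff_const, contDiff_const, fun y _ => ?_⟩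
  simp

/-- The zero pair solves the homogeneous resolvent equation. [folklore] -/
theorem lin_zero_realW (r : ℝ) (W S : ℝ → ℝ) (Λ : ℂ) (x : ℝ) :
    Λ * (((0:ℝ) : ℂ)) - linW r W S (fun _ => ((0:ℝ) : ℂ)) (fun _ => ((0:ℝ) : ℂ)) x = ((0:ℝ) : ℂ) ∧
    Λ * (((0:ℝ) : ℂ)) - linS r W S (fun _ => ((0:ℝ) : ℂ)) (fun _ => ((0:ℝ) : ℂ)) x = ((0:ℝ) : ℂ) := by
  unfold linW linS
  simp

/-- **Stub `stub_packingResolventW` of line `sonic-cavity-renewal` (v8): THE PACKING-ORDER RESOLVENT WITH THE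
CENTRE-CORRECT WEIGHT.** On the pinned window, for a monatomic profile in the cavity tube with the weighted-`C⁵` cavity
resolvent and the pinned rate: `PackingResolventW r W S` — existence at every order (`packingResolvent_existenceW`) and, from
`k₀ = ⌈Λ₀/μ⌉ + 1` on, the `(1 + S)`-weighted Laplace gain with the `k`-uniform bound on `u₁` (`packingResolventW_apriori`).
[folklore] -/
theorem stub_packingResolventW : ∀ (r : ℝ) (W S : ℝ → ℝ), (17307 / 15625 : ℝ) ≤ r → r ≤ 697 / 625 → IsMonatomicProfile r W S → OrigProfileEqs r W S → CavityTube r W S → CavityTubeWedgeLoop r W S → CavityTubeBulk r W S → BoxPackage r W S → RealBound r W S → SonicConfinement r W S → CavityResolventCk 5 r W S → PinnedRate r W S → PackingResolventW r W S := by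
  intro r W S hlo hhi hP _hO hT _hWL _hB _hbox _hre _him hres hRate
  obtain ⟨Λ₀, C, hΛ₀, hC, hapr⟩ := packingResolventW_apriori r W S hlo hhi hP hT
  have hSpos : ∀ x, 0 < S x := hP.2.2.2.2.1
  set μ : ℝ := 3 * (r - 1) with hμ
  have hμpos : 0 < μ := by rw [hμ]; linarith
  set k₀ : ℕ := ⌈Λ₀ / μ⌉₊ + 1 with hk₀_def
  refine ⟨k₀, C / μ + C, by positivity, fun k hk f₁ f₂ hf N hN => ?_⟩
  have hk1 : (1:ℝ) ≤ k := by exact_mod_cast hk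
  have hkpos : (0:ℝ) < k := by linarith
  -- `N ≥ 0`; the case `N = 0`: the source vanishes, take the zero pair
  have hN0 : 0 ≤ N := le_trans (add_nonneg (div_nonneg (abs_nonneg _) (by linarith [hSpos 0]))
    (div_nonneg (abs_nonneg _) (hSpos 0).le)) (hN 0)
  rcases eq_or_lt_of_le hN0 with hNz | hNpos
  · have hf0 : ∀ y, f₁ y = 0 ∧ f₂ y = 0 := by
      intro y
      have h := hN y
      rw [← hNz] at h
      have h1 : 0 ≤ |f₁ y| / (1 + S y) := div_nonneg (abs_nonneg _) (by linarith [hSpos y])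
      have h2 : 0 ≤ |f₂ y| / S y := div_nonneg (abs_nonneg _) (hSpos y).le
      have h3 : |f₁ y| / (1 + S y) = 0 := by linarith
      have h4 : |f₂ y| / S y = 0 := by linarith
      rw [div_eq_zero_iff] at h3 h4
      refine ⟨abs_eq_zero.1 (h3.resolve_right (by linarith [hSpos y])), abs_eq_zero.1 (h4.resolve_right (hSpos y).ne')⟩
    refine ⟨fun _ => 0, fun _ => 0, isRegularPair_zero_realW, fun x => ?_, ⟨0, fun y => by simp⟩, fun _ => ⟨fun y => ?_, fun _ y => ?_⟩⟩
    · obtain ⟨h1, h2⟩ := hf0 x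
      rw [h1, h2]
      exact lin_zero_realW r W S _ x
    · rw [← hNz]; simp
    · rw [← hNz]; simp
  · -- `N > 0`: the solution of `packingResolvent_existenceW` and the a-priori estimate
    obtain ⟨u₁, u₂, hu, hsol, hfin⟩ := packingResolvent_existenceW r W S hlo hhi hP hT hres hRate k hk f₁ f₂ hf ⟨N, hN⟩
    refine ⟨u₁, u₂, hu, hsol, hfin, fun hk₀ => ?_⟩
    obtain ⟨N', hN'⟩ := hfin
    -- the order is large: `kμ ≥ Λ₀`
    have hΛ : Λ₀ ≤ (k : ℝ) * μ := by
      have h1 : (k₀ : ℝ) ≤ k := by exact_mod_cast hk₀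
      have h2 : Λ₀ / μ ≤ ⌈Λ₀ / μ⌉₊ := Nat.le_ceil _
      have h3 : (k₀ : ℝ) = ⌈Λ₀ / μ⌉₊ + 1 := by rw [hk₀_def]; push_cast; ring
      have h4 : Λ₀ / μ ≤ k := by linarith
      rwa [div_le_iff₀ hμpos] at h4
    -- real data
    obtain ⟨hu₁d, -⟩ := differentiable_real_of_coe_contDiffW hu.1
    obtain ⟨hu₂d, -⟩ := differentiable_real_of_coe_contDiffW hu.2.1
    obtain ⟨-, hf₁c⟩ := differentiable_real_of_coe_contDiffW hf.1
    obtain ⟨-, hf₂c⟩ := differentiable_real_of_coe_contDiffW hf.2.1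
    have hreal := realEqs_of_coe (Λ := (k : ℝ) * μ) hu₁d hu₂d hsol
    have key := hapr ((k : ℝ) * μ) hΛ u₁ u₂ f₁ f₂ N N' hNpos hu₁d hu₂d hf₁c hf₂c hreal hN hN'
    have hCμ : C * N / ((k : ℝ) * μ) ≤ (C / μ + C) * N / k := by
      have e1 : C * N / ((k : ℝ) * μ) = (C / μ) * N / k := by field_simp
      rw [e1]
      apply div_le_div_of_nonneg_right _ hkpos.le
      have := mul_nonneg hC.le hNpos.le
      nlinarith only [this, hμpos, hC, hNpos]
    refine ⟨fun y => (key y).1.trans hCμ, fun _ y => (key y).2.trans ?_⟩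
    have : C ≤ C / μ + C := by linarith [div_pos hC hμpos]
    exact mul_le_mul_of_nonneg_right this hNpos.le

end Summit.AtomisticToContinuum.HydrodynamicLimit.Theorems.PackingAnalyticImplosion

end
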